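import Literature.MathematicalPhysics.KineticTheory.ConfinedReach
import Literature.Probability.Process.SmallSets
import HarnessLib

/-!
# Additive-noise SDEs with a confined drift: uniform stochastic continuity, and a local small set from a one-time minorisation

Trunk T-KINETIC (Literature/MathematicalPhysics/KineticTheory). Model-free versions (pathwise flow
`drivenFlow` and kernels `sdeKernel` of a `ConfinedDrift`, `ConfinedForcedFlow.lean` /
`ConfinedDriftKernel.lean`) of the last two steps of `LangevinChainLocalMinorization.lean` (there for
the pinned chain and the older pipeline):

* `ConfinedDrift.exists_norm_flow_zero_sub_le` — the undriven flow moves by `O(s)`: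
  `‖φ_s(w) - w‖ ≤ s·C` for `s ∈ [0, 1]`, uniformly on an energy sublevel set (a-priori ball +
  continuity of the drift);
* `ConfinedDrift.sdeKernel_ball_ge_half` — **uniform stochastic continuity**: for every point `x₀`
  and `ε₁ > 0` there is `δ > 0` with `P_s(w, B(x₀, ε₁)) ≥ 1/2` for all `s ≤ δ` and all
  `w ∈ B(x₀, ε₁/2)` (noise continuity of the flow, `ConfinedReach.lean`, and the Doob bound for
  the Brownian pair, `goodEvent` / `measure_compl_goodEvent_le` of `BrownianSupTail.lean`);
* `smul_le_kernel_of_minorization_of_stay` — **a minorisation at ONE time `t₁` on a ball, plus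
  uniform stochastic continuity at its centre, give a local small set on a time WINDOW**
  `[t₁, t₁ + δ]` (Chapman–Kolmogorov, `MarkovSemigroup.smul_le_comp`): the shape of hypothesis
  `hloc` of the small-set theorems (`SmallSets.lean`) and of
  `OscillatorChain.IsConfining.invariant_unique_of_localSmall` / the Hairer–Mattingly glue theorem
  `HairerMattingly2009_threeOscillators_of_thm56_of_lebesgueLocalSmall`.

So, for a confining chain, the uniqueness of the steady state is reduced to a minorisation of
`P_{t₁}(w, ·)` by Lebesgue measure on one ball, for `w` near the equilibrium, at one time `t₁`.

## References

* N. Cuneo, J.-P. Eckmann, M. Hairer, L. Rey-Bellet, EJP **23** (2018) no. 55, Prop. 3.6 (proof).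
* D. Revuz, M. Yor, *Continuous Martingales and Brownian Motion* (1999), Ch. II (Doob's maximal
  inequality). [folklore]
-/

noncomputable section

open MeasureTheory ProbabilityTheory Filter Topology Set Metric
open scoped NNReal ENNReal

namespace Literature.MathematicalPhysics.KineticTheory

open Literature.Probability.Process Literature.Analysis.ODE

/-! ### A one-time minorisation plus stochastic continuity give a window -/

/-- **From a minorisation at one time to a local small set on a window.** For Markov kernels with
the Chapman–Kolmogorov law, if `κ t₁ (w, ·) ≥ ν` for all `w` in a set `B` and
`κ s (w, B) ≥ 1/2` for all `s ≤ δ` and `w ∈ G`, then `κ t (w, ·) ≥ ½ν` for all `w ∈ G` and all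
`t ∈ [t₁, t₁ + δ]`. [folklore] -/
theorem smul_le_kernel_of_minorization_of_stay {X : Type*} [MeasurableSpace X]
    (κ : ℝ≥0 → Kernel X X) (h_add : ∀ s t : ℝ≥0, κ (s + t) = κ t ∘ₖ κ s)
    {B G : Set X} {t₁ : ℝ≥0} {ν : Measure X} (hmin : ∀ w ∈ B, ν ≤ κ t₁ w)
    {δ : ℝ} (hstay : ∀ s : ℝ≥0, (s : ℝ) ≤ δ → ∀ w ∈ G, 2⁻¹ ≤ κ s w B)
    (t : ℝ≥0) (ht1 : (t₁ : ℝ) ≤ t) (ht2 : (t : ℝ) ≤ t₁ + δ) (w : X) (hw : w ∈ G) :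
    (2⁻¹ : ℝ≥0∞) • ν ≤ κ t w := by
  set s : ℝ≥0 := t - t₁ with hs
  have hts : t = s + t₁ := by
    rw [hs, tsub_add_cancel_of_le (by exact_mod_cast ht1)]
  have hsδ : (s : ℝ) ≤ δ := by
    have : ((t - t₁ : ℝ≥0) : ℝ) = t - t₁ := NNReal.coe_sub (by exact_mod_cast ht1)
    rw [hs, this]
    linarith
  have hck := MarkovSemigroup.smul_le_comp κ h_add s t₁ w B hmin
  rw [hts]
  exact (IsOrderedSMul.smul_le_smul_right _ _ (hstay s hsδ w hw) ν).trans hck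

variable {E : Type*} [NormedAddCommGroup E] [NormedSpace ℝ E] [FiniteDimensional ℝ E]
  [CompleteSpace E]

namespace ConfinedDrift

variable {Y : E → E} (D : ConfinedDrift Y)
include D

/-! ### The undriven flow moves by `O(s)` -/

/-- **The undriven flow moves by `O(s)`, uniformly on an energy sublevel set**: for every `E₀`
there is `C ≥ 0` with `‖φ_s(w) - w‖ ≤ s C` for all `s ∈ [0, 1]` and all `w` with `V(w) ≤ E₀`
(the orbit stays in the a-priori ball, on which the continuous drift is bounded). [folklore] -/
theorem exists_norm_flow_zero_sub_le (E₀ : ℝ) :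
    ∃ C : ℝ, 0 ≤ C ∧ ∀ w : E, D.V w ≤ E₀ → ∀ s ∈ Icc (0 : ℝ) 1,
      ‖drivenFlow Y w 0 s - w‖ ≤ s * C := by
  set R₁ : ℝ := D.apriori E₀ 0 1 with hR₁
  obtain ⟨C, hC⟩ := (isCompact_closedBall (0 : E) R₁).exists_bound_of_continuousOn
    (D.contDiff_drift.continuous.continuousOn)
  have h0S : ∀ t : ℝ, (0 : ℝ → E) t ∈ D.noise := fun _ => D.noise.zero_mem
  have h0M : ∀ t ∈ Icc (0 : ℝ) 1, ‖(0 : ℝ → E) t‖ ≤ 0 := fun t _ => by simp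
  refine ⟨max C 0, le_max_right _ _, fun w hw s hs => ?_⟩
  have hsol := D.isIntegralSolutionOn_flow w continuous_zero h0S 1 s hs
  simp only [Pi.zero_apply, add_zero] at hsol
  rw [hsol, add_sub_cancel_left]
  have hb : ∀ u ∈ Set.uIoc (0 : ℝ) s, ‖Y (drivenFlow Y w 0 u)‖ ≤ max C 0 := by
    intro u hu
    rw [uIoc_of_le hs.1] at hu
    refine (hC _ ?_).trans (le_max_left _ _)
    rw [mem_closedBall, dist_zero_right]
    exact (D.norm_flow_le w continuous_zero h0S h0M u ⟨hu.1.le, hu.2.trans hs.2⟩).trans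
      (D.apriori_mono 0 1 hw)
  have := intervalIntegral.norm_integral_le_of_norm_le_const hb
  rwa [sub_zero, abs_of_nonneg hs.1, mul_comm] at this

/-! ### Uniform stochastic continuity -/

variable [MeasurableSpace E] [BorelSpace E] [SecondCountableTopology E] {v₁ v₂ : E}
  (hv₁ : v₁ ∈ D.noise) (hv₂ : v₂ ∈ D.noise)
include hv₁ hv₂

/-- **Uniform stochastic continuity**: for every point `x₀` and every `ε₁ > 0` there is `δ > 0`
such that `P_s(w, B(x₀, ε₁)) ≥ 1/2` for all `s ≤ δ` and all `w ∈ B(x₀, ε₁/2)`: the undriven flow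
moves by `O(s)`, the driven flow is uniformly `ε₁/4`-close to it when the Brownian pair is small on
`[0, s]` (`exists_norm_flow_sub_flow_lt`), and the latter has probability `≥ 1/2` for short `s`
(`measure_compl_goodEvent_le`). [folklore] -/
theorem sdeKernel_ball_ge_half (x₀ : E) {ε₁ : ℝ} (hε₁ : 0 < ε₁) :
    ∃ δ : ℝ, 0 < δ ∧ ∀ s : ℝ≥0, (s : ℝ) ≤ δ → ∀ w ∈ ball x₀ (ε₁ / 2),
      2⁻¹ ≤ sdeKernel Y v₁ v₂ s w (ball x₀ ε₁) := by
  -- energy bound on the ball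
  obtain ⟨E₀, hE₀⟩ := (isCompact_closedBall x₀ ε₁).exists_bound_of_continuousOn
    (D.continuous_energy.continuousOn)
  have hE₀' : ∀ w ∈ ball x₀ (ε₁ / 2), D.V w ≤ E₀ := fun w hw =>
    (Real.le_norm_self _).trans (hE₀ w (by
      rw [mem_closedBall]; rw [mem_ball] at hw; linarith))
  -- the undriven flow moves by `O(s)`
  obtain ⟨CY, hCY0, hCY⟩ := D.exists_norm_flow_zero_sub_le E₀
  -- continuity in the noise on `[0, 1]`, noise bounded by `1`
  obtain ⟨δ₁, hδ₁, hnoise⟩ := D.exists_norm_flow_sub_flow_lt E₀ 1 1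
    (show (0 : ℝ) < ε₁ / 4 by positivity)
  -- the noise amplitude on the good event
  set a : ℝ := min δ₁ 1 / (‖v₁‖ + ‖v₂‖ + 1) with ha
  have hC : 0 < ‖v₁‖ + ‖v₂‖ + 1 := by positivity
  have hapos : 0 < a := div_pos (lt_min hδ₁ one_pos) hC
  have habound : (‖v₁‖ + ‖v₂‖) * a ≤ min δ₁ 1 := by
    rw [ha, mul_div_assoc', div_le_iff₀ hC]
    have : 0 ≤ min δ₁ 1 := (lt_min hδ₁ one_pos).le
    nlinarith
  -- the time scale
  set δ : ℝ := min (a ^ 2 / 4) (min 1 (ε₁ / (4 * (CY + 1)))) with hδ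
  have hδpos : 0 < δ := by positivity
  refine ⟨δ, hδpos, fun s hs w hw => ?_⟩
  have hs1 : (s : ℝ) ≤ 1 := hs.trans ((min_le_right _ _).trans (min_le_left _ _))
  have hsa : (s : ℝ) ≤ a ^ 2 / 4 := hs.trans (min_le_left _ _)
  have hsε : (s : ℝ) ≤ ε₁ / (4 * (CY + 1)) := hs.trans ((min_le_right _ _).trans (min_le_right _ _))
  have hwE : D.V w ≤ E₀ := hE₀' w hw
  have hwx : dist w x₀ < ε₁ / 2 := hw
  have h0S : ∀ t : ℝ, (0 : ℝ → E) t ∈ D.noise := fun _ => D.noise.zero_mem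
  -- on the good event the solution is in the ball
  have hsub : goodEvent a s ⊆ (fun ω => sdeSolMap Y v₁ v₂ s w (pairPath ω)) ⁻¹' ball x₀ ε₁ := by
    intro ω hωg
    rw [mem_preimage, mem_ball]
    set nω : ℝ → E := pairNoise v₁ v₂ (pairPath ω) with hnω
    have hnc : Continuous nω := continuous_pairNoise v₁ v₂ (pairPath ω)
    have hnS : ∀ t, nω t ∈ D.noise := fun t => pairNoise_mem v₁ v₂ hv₁ hv₂ _ t
    have hnsmall : ∀ t ∈ Icc (0 : ℝ) s, ‖nω t‖ ≤ min δ₁ 1 := by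
      intro t ht
      obtain ⟨h1, h2⟩ := abs_brownian_toNNReal_le_of_mem_goodEvent hωg ht.2
      refine (norm_pairNoise_pairPath_le v₁ v₂ ω t).trans (le_trans ?_ habound)
      have hv₁0 : 0 ≤ ‖v₁‖ := norm_nonneg _
      have hv₂0 : 0 ≤ ‖v₂‖ := norm_nonneg _
      nlinarith [mul_le_mul_of_nonneg_left h1 hv₁0, mul_le_mul_of_nonneg_left h2 hv₂0]
    -- the noise stopped at `s`: bounded by `min δ₁ 1` on `[0, 1]`, equal to `nω` on `[0, s]`
    set ns : ℝ → E := fun t => nω (min t s) with hns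
    have hnsc : Continuous ns := hnc.comp (continuous_id.min continuous_const)
    have hnsS : ∀ t, ns t ∈ D.noise := fun t => hnS _
    have hns_bound : ∀ t ∈ Icc (0 : ℝ) 1, ‖ns t‖ ≤ min δ₁ 1 := fun t ht =>
      hnsmall (min t s) ⟨le_min ht.1 s.coe_nonneg, min_le_right _ _⟩
    have hflow_s : drivenFlow Y w nω s = drivenFlow Y w ns s :=
      D.flow_congr w hnc hnsc hnS hnsS (T := s)
        (fun t ht => by simp [hns, min_eq_left ht.2]) ⟨s.coe_nonneg, le_rfl⟩
    have h1 : ‖drivenFlow Y w ns s - drivenFlow Y w 0 s‖ < ε₁ / 4 :=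
      hnoise w hwE ns 0 hnsc continuous_const hnsS h0S
        (fun t ht => (hns_bound t ht).trans (min_le_right _ _)) (fun t _ => by simp)
        (fun t ht => by simpa using (hns_bound t ht).trans (min_le_left _ _)) s ⟨s.coe_nonneg, hs1⟩
    have h2 : ‖drivenFlow Y w 0 s - w‖ ≤ s * CY := hCY w hwE s ⟨s.coe_nonneg, hs1⟩
    have h2' : (s : ℝ) * CY < ε₁ / 4 := by
      calc (s : ℝ) * CY ≤ ε₁ / (4 * (CY + 1)) * CY := mul_le_mul_of_nonneg_right hsε hCY0
        _ < ε₁ / 4 := by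
            rw [div_mul_eq_mul_div, div_lt_div_iff₀ (by positivity) (by positivity)]
            nlinarith
    have hsol : sdeSolMap Y v₁ v₂ s w (pairPath ω) = drivenFlow Y w nω s := rfl
    rw [hsol, hflow_s, dist_eq_norm]
    calc ‖drivenFlow Y w ns s - x₀‖ = ‖(drivenFlow Y w ns s - drivenFlow Y w 0 s) +
          (drivenFlow Y w 0 s - w) + (w - x₀)‖ := by congr 1; abel
      _ ≤ ‖drivenFlow Y w ns s - drivenFlow Y w 0 s‖ + ‖drivenFlow Y w 0 s - w‖ + ‖w - x₀‖ :=
          norm_add₃_le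
      _ < ε₁ / 4 + ε₁ / 4 + ε₁ / 2 := by
          have : ‖w - x₀‖ < ε₁ / 2 := by rwa [← dist_eq_norm]
          linarith
      _ = ε₁ := by ring
  -- probability of the good event
  have hgood : 2⁻¹ ≤ wienerPair (goodEvent a s) := by
    have hsa' : (s : ℝ) < a ^ 2 := by nlinarith
    have hcompl := measure_compl_goodEvent_le hapos.le s hsa'
    have hbound : 2 * ENNReal.ofReal (2 * (s : ℝ) ^ 2 / (a ^ 2 - s) ^ 2) ≤ 2⁻¹ := by
      have hden : 3 * a ^ 2 / 4 ≤ a ^ 2 - s := by nlinarith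
      have hden0 : 0 < 3 * a ^ 2 / 4 := by positivity
      have hs0 : (0 : ℝ) ≤ s := s.coe_nonneg
      have hreal : 2 * (s : ℝ) ^ 2 / (a ^ 2 - s) ^ 2 ≤ 2 / 9 := by
        rw [div_le_div_iff₀ (by positivity) (by norm_num)]
        have h1 : (s : ℝ) ^ 2 ≤ (a ^ 2 / 4) ^ 2 := pow_le_pow_left₀ hs0 hsa 2
        have h2 : (3 * a ^ 2 / 4) ^ 2 ≤ (a ^ 2 - s) ^ 2 := pow_le_pow_left₀ hden0.le hden 2
        nlinarith
      calc 2 * ENNReal.ofReal (2 * (s : ℝ) ^ 2 / (a ^ 2 - s) ^ 2) ≤ 2 * ENNReal.ofReal (2 / 9) := by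
            gcongr
        _ = ENNReal.ofReal (4 / 9) := by
            rw [← ENNReal.ofReal_ofNat, ← ENNReal.ofReal_mul (by norm_num)]; norm_num
        _ ≤ ENNReal.ofReal (1 / 2) := ENNReal.ofReal_le_ofReal (by norm_num)
        _ = 2⁻¹ := by rw [one_div, ENNReal.ofReal_inv_of_pos two_pos, ENNReal.ofReal_ofNat]
    have hprob : wienerPair (goodEvent a s) = 1 - wienerPair (goodEvent a s)ᶜ := by
      rw [prob_compl_eq_one_sub (measurableSet_goodEvent a s),
        ENNReal.sub_sub_cancel ENNReal.one_ne_top prob_le_one]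
    rw [hprob]
    have h3 : wienerPair (goodEvent a s)ᶜ ≤ 2⁻¹ := hcompl.trans hbound
    calc (2⁻¹ : ℝ≥0∞) = 1 - 2⁻¹ := by norm_num [ENNReal.one_sub_inv_two]
      _ ≤ 1 - wienerPair (goodEvent a s)ᶜ := tsub_le_tsub_left h3 1
  rw [D.sdeKernel_apply' hv₁ hv₂ s w measurableSet_ball]
  exact hgood.trans (measure_mono hsub)

/-- **A one-time Lebesgue minorisation near a point gives a local small set** for the kernels
`sdeKernel` of a confined drift: if at some time `t₁`, for all `w ∈ B(x₀, ε₁)`,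
`P_{t₁}(w, ·) ≥ c · Λ|_{U₀}` (a reference measure `Λ`, e.g. Lebesgue, on an open `U₀`), then on
`G₀ = B(x₀, ε₁/2)` and the window `[t₁, t₁ + δ]` of `sdeKernel_ball_ge_half`,
`P_t(w, ·) ≥ (c/2) · Λ|_{U₀}`. [folklore] -/
theorem exists_window_smul_restrict_le_sdeKernel (x₀ : E) {ε₁ : ℝ} (hε₁ : 0 < ε₁) {t₁ : ℝ≥0}
    {Λ : Measure E} {U₀ : Set E} {c : ℝ≥0∞}
    (hmin : ∀ w ∈ ball x₀ ε₁, c • Λ.restrict U₀ ≤ sdeKernel Y v₁ v₂ t₁ w) :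
    ∃ δ : ℝ, 0 < δ ∧ ∀ t : ℝ≥0, (t₁ : ℝ) ≤ t → (t : ℝ) ≤ t₁ + δ → ∀ w ∈ ball x₀ (ε₁ / 2),
      (2⁻¹ * c) • Λ.restrict U₀ ≤ sdeKernel Y v₁ v₂ t w := by
  obtain ⟨δ, hδ, hstay⟩ := D.sdeKernel_ball_ge_half hv₁ hv₂ x₀ hε₁
  refine ⟨δ, hδ, fun t ht1 ht2 w hw => ?_⟩
  rw [← smul_smul]
  exact smul_le_kernel_of_minorization_of_stay (sdeKernel Y v₁ v₂) (D.sdeKernel_add hv₁ hv₂) hmin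
    hstay t ht1 ht2 w hw

end ConfinedDrift

end Literature.MathematicalPhysics.KineticTheory

end
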